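import Summits.AtomisticToContinuum.HydrodynamicLimit.Theses.ImplosionDichotomy
import Literature.Analysis.FluidPDE.CompressibleEulerImplosion
import Literature.Analysis.FluidPDE.CompressibleEulerImplosionMonatomicHolds
import Summits.AtomisticToContinuum.HydrodynamicLimit.Theorems.ImplosionDichotomyDenseExcursionProjectiveCovariance
import Summits.AtomisticToContinuum.HydrodynamicLimit.Theorems.ImplosionDichotomyDenseExcursionTiedStatics
import Summits.AtomisticToContinuum.HydrodynamicLimit.Theorems.ImplosionDichotomyDenseExcursionKnobFamily
import Summits.AtomisticToContinuum.HydrodynamicLimit.Theorems.ImplosionDichotomyDenseExcursionKidderKnob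
import Summits.AtomisticToContinuum.HydrodynamicLimit.Theorems.ImplosionDichotomyHsEosLowDensity
import Summits.AtomisticToContinuum.HydrodynamicLimit.Theorems.ImplosionDichotomyDenseExcursionConeLocality
import Summits.AtomisticToContinuum.HydrodynamicLimit.Theorems.ImplosionDichotomyDenseExcursionMemberCore

/-!
# Line `kidder-knob-melnikov` — crux `ImplosionDichotomy.DenseExcursion` (stmt-AtomisticToContinuum-12586)

**v3.2 (2026-08-16T20Z, r2 lead c3-0, courtesy to the fallback line; NOT re-registered, no kidder signature changed):**
`stub_bcgProfile` is wired to the Literature theorem `BuckmasterCaolaboraGomezserrano2025_thm11_monatomic_holds`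
(`CompressibleEulerImplosionMonatomicHolds.lean`, 18:43Z). Open `sorry`: exactly ONE — `stub_knobTracking` (the heart).

Skeleton (crux-plan, round 1) of the idea card `Ideas/kidder-knob-melnikov.md` (ideator 2), merged — as all
three triagers recommend — with its other half `Ideas/r2-one-mode-two-conditions.md`.

**The line in one paragraph.** `DenseExcursion` asks for ONE σ-independent continuous positive profile
`(a₀, u₀, θ₀)` whose admissible hard-sphere-Euler developments reach packing `η` along `σ → 0`. Seed the unit
torus with the first smooth spherically symmetric self-similar implosion `SS(r₂)` of the monatomic ideal gas
(`γ = 5/3`, blow-up speed `r₂ ≈ 1.11282`, the Buckmaster–Cao-Labora–Gómez-Serrano profile) cut off outside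
a small ball. The monatomic gas is the projectively invariant one: the Kidder/Schrödinger map
`(ρ,u,θ)(t,x) ↦ (λ³ρ, λ(u − b x), λ²θ)(λt, λx)`, `λ = 1/(1 − b t)`, sends classical `σ = 0` solutions to
classical `σ = 0` solutions, so the velocity shear `u₀ ↦ u₀ − b·(x − x₀)` inside the ball (the KNOB `b`,
`bT > −1`) produces an EXACT one-parameter family of imploding ideal developments, blowing up at
`T/(1 + bT)`, with `a₀, θ₀` — hence the local-Gibbs data and their `O(σ³)` excluded-volume defect —
independent of `b`. Around `SS(r₂)` the computed radial smooth spectrum has exactly one genuine unstable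
mode `Λ₁ ≈ 0.79711` against the packing clock `μ = 3(r₂ − 1) ≈ 0.33845` (three independent codes, kit
j006166 / j007023 / j007007; `2μ < Λ₁ < 3μ`), so forced modulation stability for the hard-sphere law
`p = ρθZ(ρσ³)` reduces "reaches packing η" on the two-parameter family (knob `b` × one stable-manifold
direction `β`) to the vanishing of TWO real Melnikov numbers `K₁(b,β)` (order `σ³`) and `K₂(b,β)` (order
`σ⁶`); pulling the σ-problem back along the knob by the exact symmetry (diameter `σ(1+bs)`, heating anomaly
`2b/(1+bs)·θ(Z−1)`) makes `b ↦ K₁(b,β)` a CUBIC POLYNOMIAL (triage sharpening), so the first condition is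
four quadratures per `β`, and the second is met on the genuinely two-parameter family (triage: a common
transversal zero of `(K₁, K₂)` is needed, not an IFT step in `b` alone).

**Typed architecture (planner's design, as reshaped).** The analytic objects (linearised operator, adjoint
mode, Melnikov integrals) are not Lean objects yet, so the load-bearing statement is phrased through an
intrinsic, PDE-level tracking predicate `TracksTo` of the family (an admissible σ-solution shadows the
time-modulated ideal member on the self-similarly shrinking core until its central packing reaches the
threshold). The exact `σ = 0` family is an interface `KnobFamily` (consumed universally), its stable-manifold
thickening `StableExtension F` is produced, together with the tracking member, by `stub_knobTracking`.

**Registered stubs** (sorried; RESHAPED by the line lead 2026-08-16, see §Reshape): `stub_projectiveCovariance`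
(M; literally the identity of the sibling line `PolynomialCompression/Lines/conformal-clock.lean` — one proof
serves both cruxes), `stub_tiedStatics` (M–L), `stub_kidderKnob` (L), `stub_knobTracking` (XL, the HARDEST, held
by the lead). Composition (sorry-free): `denseExcursion_of_parts`, `DenseExcursion_of` — CONDITIONAL on the
named fact `Literature.Analysis.FluidPDE.BuckmasterCaolaboraGomezserrano2025_thm11_monatomic` (BCG 2025
Thm 1.1 at `γ = 5/3`) and on the route support `HsEosLowDensity` (stmt-0768), both taken BY NAME.
LANDED (wave 1, 2026-08-16): stub 0 `Theorems.KidderKnobMelnikov.stub_projectiveCovariance` (p72839), stub 1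
`Theorems.KidderKnobMelnikov.stub_tiedStatics` (p73015; helper `…TiedStaticsRatio` p72666), stub-2 helper
`Theorems.KidderKnobMelnikov.exists_knobProfile` (p73194) + the BCG named fact (p72836).

**Reshape (lead, cycle 1).** The planner's stubs 3–4 were `stub_melnikovReduction : … → ∀ F E, Nonempty
(MelnikovReduction F E)` (an interface carrying two functions `K₁, K₂` PINNED by `K₁ = 0 ↔ TracksTo …(σ^{e_H})`,
`K₁ = K₂ = 0 ↔ TracksTo …(η)`) and `stub_knobTransfer : ∀ F, ∃ E, ∀ R : MelnikovReduction F E, ∃ common zero`.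
The pins do NOT pin: the structure's constants `(η, M, δ, e_H)` were free fields, and the tracking sets they
define depend on them, so (i) whenever no member tracks WITHOUT time modulation (`M = 0`, `e_H → 0⁺`: the
`O(σ³)` blow-up-time shift of a generic member makes unmodulated shadowing down to central packing `σ^{e_H}`
impossible — the generic situation in the intended model) the constant instance `K₁ ≡ K₂ ≡ 1` is a legal
`MelnikovReduction`, which makes `stub_melnikovReduction` vacuously true-in-model and `stub_knobTransfer`
(quantifying over ALL instances, hence over this zero-free one) false-in-model; (ii) conversely no sound split of
"reduction" from "common zero" is typable before the Melnikov functions are Lean DEFINITIONS (route definition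
request D1). The two stubs are therefore merged into the one statement the composition consumes,
`KnobTracking` (some member of some stable extension tracks to a fixed packing), with the Melnikov structure kept
as its documented proof plan; stubs 0–1 are byte-identical to the planner's.

**Reshape 2 (lead, after wave 1).** `KnobFamily`/`StableExtension` are now KINEMATIC: the planner's fields
`sol` (a classical ideal development of every member on the WHOLE torus up to its Kidder time) are dropped,
and the profile clauses `smoothProfile`, `profileODE`, `farField` (verbatim the conclusion of the landed
`exists_knobProfile`) are added. Reason (stub-2 worker, `stub-blocked`): `sol` needs the unvendored classical
Cauchy theory of compressible Euler on `𝕋³` (local existence, continuation, domain of dependence) plus an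
unpublished exterior-lifespan estimate for every sheared member, while NOTHING downstream reads it — the
composition only reads `cont`, `pos`, `x₀` and the tracking statement, whose reference fields live on the
core, where they solve the ideal system by `profileODE` + `ProjectiveCovariance`. `KidderKnob` now takes the
BCG profile theorem by name; `stub_knobTracking` takes `HsEosLowDensity` by name.

**Disproof.lean (cdisprove v4) honoured** (file text not mounted on this box; theorem names from the item's
evidence notes): the `t = 0` tie is load-bearing (`denseExcursionWithoutTie_holds`: without it the crux is
trivial) — here the tie is PRODUCED by `stub_tiedStatics` and carried by every tracked solution
(`IsAdmissible`); `a₀ > 0`, `θ₀ > 0` (`…WithoutActivityPos/TemperaturePos_holds`) are fields of the family;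
the refuted strengthenings `not_denseExcursionAtTimeZero`, `not_denseExcursionEverywhere` are respected (the
dense event is the self-similar core at `t → T/(1+bT)`, initial packing `O(σ³)` as in
`admissible_initialPacking_le`, dense volume `≍ (T−t)^{3/r}` as in `volume_denseSet_le` /
`denseExcursion_shape`); the two-sided identification `admissible_initialDensity_sub_le` (`|ρ(0) − a₀/∫a₀| ≤
16A²σ³/(∫a₀)²`) is the `m = 0` shadow of `TiedStatics` (whose first-order coefficient `defect₁` integrates to
`0`, matching `integral_density_eq_one`); §7's remark (global density rescaling is an exact symmetry, no
unstable projection) is why the data enter `K₁` only through the LOCAL part `b ↦ b²` of `defect₁` and the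
knob; §8 / RaceResults (`(m,J) = (1,2)` at `SS(r₂)`) is the proof plan of `stub_knobTracking` (two tuning conditions).

**Reshape 3 (lead seat prover-line-…-12586-2, 2026-08-16T11Z).** (i) `hZ : HsEosLowDensity` is DISCHARGED by the tree
theorem `Theorems.hsEosLowDensity_proof` (stmt-0768 closed), so `DenseExcursion_of : DenseExcursion` is unconditional
modulo the registered stubs. (ii) Two typable pieces of the heart that the standing disprover lists as silently used and
"still NOT in the tree" (Disproof §9 (i): "the line silently uses ConeLocality (domain of dependence for the REAL-gas
system)"; gen-4 census item 1) are split off `stub_knobTracking` as registered stubs, now that the tree PROVES their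
templates (`IsentropicEuler.eqOn_cone_of_eqOn_ball(_var)` — finite speed of propagation for the isentropic system after
Dafermos Thm 5.2.1; `IsHardSphereEulerSolution.relativeEnergy_balance` / `unique_of_smooth_eos` — the symmetrised
relative energy of the full athermal `5 × 5` system; `CaolaboraEtAl2025.eqOn_cone_of_profile` — cone identification at
the core of the exact self-similar solution): `stub_coneLocality : HsEulerConeLocality` (domain of dependence in
acoustic cones for two `C¹` solutions of the full Euler system of a monatomic fluid with ONE smooth athermal law
`p = ρθζ(ρ)` — `ζ ≡ 1` is the ideal gas, `ζ(r) = Z(rσ³)` the hard-sphere gas below the EOS threshold) and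
`stub_memberCore : HsEulerConeLocality → ProjectiveCovariance → MemberCore` (every classical ideal development of a
knob member's data coincides, on the straight acoustic cone of the core chart ball, with the member's reference field —
the Kidder image of the exact self-similar core). `stub_knobTracking` takes both by name, keeps the XL residue (forced
modulation with `(m, J) = (1, 2)` and the two tuning conditions), and is held by the lead; total registered stubs 7.

**Integration 4 (parallel lead seat prover-line-…-12586-c2-0, 2026-08-16T16Z).** Stubs 3a–3b LANDED by seat -2 and wired
here: `stub_coneLocality := Theorems.KidderKnobMelnikov.stub_coneLocality` (p106649, byte-identical `AthermalEulerAt` /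
`HsEulerConeLocality`, defeq) and `stub_memberCore` from `Theorems.KidderKnobMelnikov.memberCore_of_coneLocality` (p105582)
by field-by-field transport between the two copies of `KnobFamily`. Open `sorry`s: exactly `stub_knobTracking` (the
heart) and `stub_bcgProfile` (the named Literature fact; its discharge `thm11_monatomic_of_left` in
`Literature/Analysis/FluidPDE/CompressibleEulerImplosionShooting.lean` awaits only the left-branch assembly). No stub
signature changed, so the registry entry of seat -2 (re-added by c1-0 at 10:45Z) stays valid and is NOT re-registered
(it shares the crux's single skeleton slot with the live r2 lead c1-0).

**Numerics c2 (2026-08-16, third disjoint code; `Cruxes/DenseExcursion/NOTES-c2.md`, item evidence `EVIDENCE-c2.md`).** The decision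
number of `stub_knobTracking` — the sign of `G₂ = −K₂/∂_bK₁` along `Z₁ = {K₁ = 0} ∩ W^s` — CHANGES SIGN: along the smooth radial W^s
direction "density bump at the sonic radius" `G₂ = 0.0905, 0.0726, 0.0572, 0.0442, 0.0323, 0.0215, 0.0106, 0.0048, 0.000 ± 0.001, −0.0152 ± 0.0003` (threshold
tracking; ε-jets `+0.0076 / −0.009` at 12 / 14 %) at bump amplitudes `0, 2, …, 12, 13, 14, 16 %`, with knob root `Z₁` moving from
`bT = −0.4234` to `−0.7494`.
So the common zero of `(K₁, K₂)` on knob × stable extension that this stub bets on exists numerically (validated against all prior numbers: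
`λ₁`, the exact cubic `K₁`, `b₀`, `G₂(0) = +0.0905 = seat -1's +0.095 ± 0.008`). The stub stays XL: forced modulation stability for
`p = ρθZ(ρσ³)` + a certified sign change.

-/

noncomputable section

open MeasureTheory Set Filter Topology
open scoped ContDiff

namespace Summit.AtomisticToContinuum.HydrodynamicLimit.Cruxes.DenseExcursion.KidderKnobMelnikov

open Literature.MathematicalPhysics.KineticTheory (T3 V3 IsHardSphereEulerSolution hsDiameter localGibbsLaw
  TendstoHydroFieldsAt)
open Literature.Analysis.FunctionSpaces (Torus.proj Torus.IsSmooth Torus.lift)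
open Summit.AtomisticToContinuum.HydrodynamicLimit.Theses.ImplosionDichotomy (DenseExcursion HsEosLowDensity)

/-! ## Admissibility (the `t = 0` tie of the crux, verbatim) -/

/-- A classical hard-sphere-Euler solution at reduced diameter `σ` is ADMISSIBLE for the profiles
`(a, u₀, θ₀)` when its `t = 0` fields are the law-of-large-numbers limit of the local Gibbs laws for every
family of hard-sphere flows — the tie used verbatim in `DenseExcursion`. -/
def IsAdmissible (σ : ℝ) (a θ₀ : T3 → ℝ) (u₀ : T3 → V3) (T : ℝ) (ρ θ : ℝ → T3 → ℝ)
    (u : ℝ → T3 → V3) : Prop :=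
  IsHardSphereEulerSolution σ T ρ u θ ∧
    ∀ Φ : (N : ℕ) → Literature.Analysis.FluidPDE.HardSphereFlow
        (Literature.Analysis.FluidPDE.Torus.geometry (Fin 3)) (hsDiameter σ N) (N + 1),
      TendstoHydroFieldsAt (fun N => localGibbsLaw σ a u₀ θ₀ N (Φ N)) Φ ρ u θ 0

/-! ## Stub 0 — the projective (Kidder / Schrödinger) covariance of the monatomic gas

The definitions of this block are, on purpose, LITERALLY those of the sibling skeleton
`Cruxes/PolynomialCompression/Lines/conformal-clock.lean` (crux stmt-12587), so that one proof of the
identity serves both registered stubs. Dictionary with the card's knob: `b = −1/a`, `λ = a/(a+s) = 1 − bt`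
read in the dual clock `s`. Re-derived by hand in this seat (mass and momentum exact with diameter
`σ(a+s)/a`, temperature anomaly `2θ(Z−1)/(a+s)`). -/

/-- The projective point map with parameter `a`: dual `(s, y) ↦` physical `(t, x) = (a s/(a+s), (a/(a+s)) y)`. -/
def clockMap (a : ℝ) (z : ℝ × V3) : ℝ × V3 := (a * z.1 / (a + z.1), (a / (a + z.1)) • z.2)

/-- Dual density `ρ̂(s,y) = λ³ ρ(t,x)`, `λ = a/(a+s)`. -/
def dualDensity (a : ℝ) (P : ℝ × V3 → ℝ) (z : ℝ × V3) : ℝ := (a / (a + z.1)) ^ 3 * P (clockMap a z)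

/-- Dual temperature `θ̂(s,y) = λ² θ(t,x)`. -/
def dualTemperature (a : ℝ) (Θ : ℝ × V3 → ℝ) (z : ℝ × V3) : ℝ := (a / (a + z.1)) ^ 2 * Θ (clockMap a z)

/-- Dual velocity `û(s,y) = λ u(t,x) + y/(a+s)`. -/
def dualVelocity (a : ℝ) (U : ℝ × V3 → V3) (z : ℝ × V3) : V3 :=
  (a / (a + z.1)) • U (clockMap a z) + (1 / (a + z.1)) • z.2

/-- `∂ₜ F (z)` on `ℝ × ℝ³`. -/
def dT {G : Type*} [NormedAddCommGroup G] [NormedSpace ℝ G] (F : ℝ × V3 → G) (z : ℝ × V3) : G :=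
  fderiv ℝ F z ((1 : ℝ), (0 : V3))

/-- `∂ᵢ F (z)` on `ℝ × ℝ³`. -/
def dX {G : Type*} [NormedAddCommGroup G] [NormedSpace ℝ G] (i : Fin 3) (F : ℝ × V3 → G) (z : ℝ × V3) : G :=
  fderiv ℝ F z ((0 : ℝ), EuclideanSpace.single i (1 : ℝ))

/-- The full Euler system of a monatomic gas (`e = 3θ/2`) with pressure law `p = ρ θ Z(ρ d(t)³)` (diameter
`d(t)`) and heating rate `h(t) θ (Z − 1)` at `z = (t, x) ∈ ℝ × ℝ³`, non-conservative form. Physical hard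
spheres: `d ≡ σ`, `h ≡ 0`; Kidder dual: `d(s) = σ(a+s)/a`, `h(s) = 2/(a+s)`. -/
def EulerZAt (d h : ℝ → ℝ) (Z : ℝ → ℝ) (P Θ : ℝ × V3 → ℝ) (U : ℝ × V3 → V3) (z : ℝ × V3) : Prop :=
  dT P z + ∑ i, dX i (fun w => P w * U w i) z = 0 ∧
  (∀ j : Fin 3, P z * (dT (fun w => U w j) z + ∑ i, U z i * dX i (fun w => U w j) z) +
      dX j (fun w => P w * Θ w * Z (P w * d w.1 ^ 3)) z = 0) ∧
  dT Θ z + ∑ i, U z i * dX i Θ z + (2 / 3) * Θ z * Z (P z * d z.1 ^ 3) * ∑ i, dX i (fun w => U w i) z =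
      h z.1 * Θ z * (Z (P z * d z.1 ^ 3) - 1)

/-- Statement of `stub_projectiveCovariance` (= the sibling line's `ProjectiveCovariance`): for every
`C¹`-at-the-point triple and every equation of state `Z` differentiable at the (projectively invariant)
packing, the physical system with diameter `σ` and no heating holds at `clockMap a (s,y)` iff the dual
system with growing diameter `σ(a+s)/a` and heating rate `2/(a+s)` holds at `(s,y)` for the dual fields.
At `Z ≡ 1` this is the projective symmetry of the monatomic ideal gas (Serre 1997, Prop. 2.1; Kidder 1974)
— the symmetry that generates the knob. -/
def ProjectiveCovariance : Prop :=
  ∀ (a σ : ℝ), 0 < a → ∀ (Z : ℝ → ℝ) (P Θ : ℝ × V3 → ℝ) (U : ℝ × V3 → V3) (z : ℝ × V3), 0 ≤ z.1 →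
    DifferentiableAt ℝ P (clockMap a z) → DifferentiableAt ℝ Θ (clockMap a z) →
    DifferentiableAt ℝ U (clockMap a z) → DifferentiableAt ℝ Z (P (clockMap a z) * σ ^ 3) →
    (EulerZAt (fun _ => σ) (fun _ => 0) Z P Θ U (clockMap a z) ↔
      EulerZAt (fun s => σ * (a + s) / a) (fun s => 2 / (a + s)) Z
        (dualDensity a P) (dualTemperature a Θ) (dualVelocity a U) z)

/-! ## Stub 1 — tied low-density statics to second order (the data defect `H` of the card) -/

/-- First-order canonical excluded-volume defect of the LLN limit density of the local Gibbs law with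
normalised activity `b = a₀/∫a₀`: `h₁(b)(x) = −(4π/3) b(x) (b(x) − ∫ b²)` (second virial coefficient of
spheres of diameter `σ(N+1)^{-1/3}` at macroscopic density `(N+1)b`, then canonical re-normalisation
`∫ρ = 1`; note `∫ h₁(b) = 0` when `∫ b = 1`). This is the card's `H/σ³`. -/
def defect₁ (b : T3 → ℝ) (x : T3) : ℝ := -(4 * Real.pi / 3) * b x * (b x - ∫ y, b y ^ 2)

/-- Statement of `stub_tiedStatics`: for continuous positive profiles with SMOOTH normalised activity
`b = a₀/∫a₀` there are `σ₁ > 0`, densities `ρ₀^σ` (`0 < σ < σ₁`) and a smooth second-order coefficient `h₂`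
with `‖ρ₀^σ − b − σ³ h₁(b) − σ⁶ h₂‖_{C^m} ≤ A_m σ⁹` for every `m`, such that each `ρ₀^σ` is smooth and
positive, the local Gibbs laws are probability measures, and their `t = 0` empirical fields satisfy the law
of large numbers towards `(ρ₀^σ, u₀, θ₀)` for every family of hard-sphere flows. (Low-density cluster
expansion of the canonical one-point density, local in the `N → ∞` limit because the physical diameter
`σ(N+1)^{-1/3} → 0`; strengthens route support `LocalGibbsDensityLimit` (stmt-12591) and the sibling line's
`SmoothStatics` by exposing the first two Taylor coefficients in `σ³` — `h₁` explicitly, since it enters the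
Melnikov number `K₁`; `h₂` (needed for `K₂`) is pinned as the coefficient and is explicit in the proof.) -/
def TiedStatics : Prop :=
  ∀ (a₀ θ₀ : T3 → ℝ) (u₀ : T3 → V3), Continuous a₀ → Continuous θ₀ → Continuous u₀ →
    (∀ x, 0 < a₀ x) → (∀ x, 0 < θ₀ x) →
    Torus.IsSmooth (fun x => a₀ x / ∫ y, a₀ y) →
    ∃ σ₁ : ℝ, 0 < σ₁ ∧ ∃ (ρ₀ : ℝ → T3 → ℝ) (h₂ : T3 → ℝ), Torus.IsSmooth h₂ ∧
      (∀ m : ℕ, ∃ A : ℝ, ∀ σ : ℝ, 0 < σ → σ < σ₁ → ∀ y,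
        ‖iteratedFDeriv ℝ m (Torus.lift (fun x => ρ₀ σ x - a₀ x / (∫ y, a₀ y)
            - σ ^ 3 * defect₁ (fun x' => a₀ x' / ∫ y, a₀ y) x - σ ^ 6 * h₂ x)) y‖ ≤ A * σ ^ 9) ∧
      (∀ σ : ℝ, 0 < σ → σ < σ₁ →
        Torus.IsSmooth (ρ₀ σ) ∧ (∀ x, 0 < ρ₀ σ x) ∧
        ∀ Φ : (N : ℕ) → Literature.Analysis.FluidPDE.HardSphereFlow
            (Literature.Analysis.FluidPDE.Torus.geometry (Fin 3)) (hsDiameter σ N) (N + 1),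
          (∀ N, IsProbabilityMeasure (localGibbsLaw σ a₀ u₀ θ₀ N (Φ N))) ∧
          TendstoHydroFieldsAt (fun N => localGibbsLaw σ a₀ u₀ θ₀ N (Φ N)) Φ
            (fun _ => ρ₀ σ) (fun _ => u₀) (fun _ => θ₀) 0)

/-! ## Stub 2 — the exact `σ = 0` object: the `SS(r₂)` seed on `𝕋³` and its Kidder knob -/

/-- **Knob family** (interface; the construction is `stub_kidderKnob`; KINEMATIC since the lead's reshape 2,
see the module docstring). A seed of the unit torus by the spherically symmetric, isentropic, exactly
self-similar implosion of the monatomic ideal gas with blow-up speed `r` in the window `(1.1, 1.135)` — it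
contains BCG's certified bracket `(1.10102, 1.13476)` of Theorem 1.1 at `γ = 5/3` (the `ν = 3, 4` Frobenius
poles; vendored as `Literature.Analysis.FluidPDE.BuckmasterCaolaboraGomezserrano2025_thm11_monatomic`) and,
numerically, exactly one smooth profile, `r₂ = 1.1128162` (RaceResults.md) — recorded by its PROFILE
(`Pf, Uf, Qf` smooth as radial fields on `ℝ³`, positive, isentropic, solving the three reduced self-similar
equations of the full ideal monatomic system, far field `P_∞`), centred at `x₀`, blowing up at time `T`, with
reference fields `ρI 0, uI 0, θI 0` EQUAL to the exact self-similar ansatz on the core chart ball `‖y‖ < Rc`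
for all `t < T`, together with its KNOB: for every `b` with `bT > bLo·T ≥ -1` (range at least
`bT > −15/16`) the velocity datum is sheared by `−b·y` inside the core (activity and temperature data
UNCHANGED) and the reference fields of member `b` are, on the core `‖y‖ < Rc(1 − bt)`, `t < T/(1+bT)`, the
exact projective (Kidder) image of member `0`. No field asserts that the reference fields solve a PDE on the
torus: on the core they solve the ideal system by the profile equations + `ProjectiveCovariance` (a lemma for
whoever needs it — the tracking stub), and off the core they are not read by anything. Local coordinates:
`y : V3 ↦ x₀ + Torus.proj y`. -/
structure KnobFamily where
  /-- centre of the seed -/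
  x₀ : T3
  /-- core chart radius (`16 Rc < 1/2`: the cores `‖y‖ < Rc (1 - b t)` of all members, `1 - b t < 16`, stay in the chart) -/
  Rc : ℝ
  /-- blow-up time of the unsheared member -/
  T : ℝ
  /-- self-similar blow-up speed (`SS(r₂)` bracket) -/
  r : ℝ
  /-- lower end of the knob (`-1 < bLo·T ≤ -15/16`) -/
  bLo : ℝ
  /-- activity datum (knob-independent) -/
  a₀ : T3 → ℝ
  /-- temperature datum (knob-independent) -/
  θ₀ : T3 → ℝ
  /-- velocity datum of member `b` -/
  u₀ : ℝ → T3 → V3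
  /-- self-similar density / radial-velocity / temperature profiles of the unsheared member -/
  Pf : ℝ → ℝ
  Uf : ℝ → ℝ
  Qf : ℝ → ℝ
  /-- ideal (`σ = 0`) development of member `b`: density, temperature, velocity -/
  ρI : ℝ → ℝ → T3 → ℝ
  θI : ℝ → ℝ → T3 → ℝ
  uI : ℝ → ℝ → T3 → V3
  hRc : 0 < Rc ∧ Rc < 1 / 32
  hT : 0 < T
  hr : 11 / 10 < r ∧ r < 227 / 200
  hbLo : -1 < bLo * T ∧ bLo * T ≤ -(15 / 16)
  cont : Continuous a₀ ∧ Continuous θ₀ ∧ ∀ b, Continuous (u₀ b)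
  pos : ∀ x, 0 < a₀ x ∧ 0 < θ₀ x
  smoothActivity : Torus.IsSmooth (fun x => a₀ x / ∫ y, a₀ y)
  /-- the knob acts on the velocity datum only, as the homologous shear `-b·y` on the core -/
  knobData : ∀ (b : ℝ) (y : V3), ‖y‖ < Rc → u₀ b (x₀ + Torus.proj y) = u₀ 0 (x₀ + Torus.proj y) - b • y
  /-- the `t = 0` slices of the reference fields are the data of the member (globally on `𝕋³`) -/
  data : ∀ b, bLo < b → (∀ x, ρI b 0 x = a₀ x / ∫ y, a₀ y) ∧ uI b 0 = u₀ b ∧ θI b 0 = θ₀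
  /-- the profiles are smooth as radial fields on `ℝ³` (density, velocity `Uf(|y|) y/|y|`, temperature) -/
  smoothProfile : ContDiff ℝ ∞ (fun y : V3 => Pf ‖y‖) ∧
    ContDiff ℝ ∞ (fun y : V3 => (Uf ‖y‖ / ‖y‖) • y) ∧ ContDiff ℝ ∞ (fun y : V3 => Qf ‖y‖)
  profilePos : ∀ ζ, 0 ≤ ζ → 0 < Pf ζ ∧ 0 < Qf ζ
  /-- isentropic core (monatomic adiabat `θ = k ρ^{2/3}`) -/
  isentropic : ∃ k : ℝ, 0 < k ∧ ∀ ζ, 0 ≤ ζ → Qf ζ = k * Pf ζ ^ (2 / 3 : ℝ)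
  /-- the three reduced self-similar equations (continuity, radial momentum with `p = ρθ`, temperature with
  `e = 3θ/2`) of the ansatz `ρ = (T−t)^{−3(1−1/r)} Pf(ζ)`, `u = (T−t)^{1/r−1} Uf(ζ) ŷ`,
  `θ = (T−t)^{2(1/r−1)} Qf(ζ)`, `ζ = R/(T−t)^{1/r}`, for `ζ > 0` (literally the conclusion of the landed
  `Theorems.KidderKnobMelnikov.exists_knobProfile`) -/
  profileODE : ∀ ζ, 0 < ζ →
    3 * (1 - 1 / r) * Pf ζ + (ζ / r + Uf ζ) * deriv Pf ζ + Pf ζ * (deriv Uf ζ + 2 * Uf ζ / ζ) = 0 ∧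
    (1 - 1 / r) * Uf ζ + (ζ / r + Uf ζ) * deriv Uf ζ + deriv Qf ζ + Qf ζ * deriv Pf ζ / Pf ζ = 0 ∧
    2 * (1 - 1 / r) * Qf ζ + (ζ / r + Uf ζ) * deriv Qf ζ +
      2 / 3 * Qf ζ * (deriv Uf ζ + 2 * Uf ζ / ζ) = 0
  /-- far field `P_∞`: `Uf/ζ → 0`, `Qf/ζ² → 0` -/
  farField : Tendsto (fun ζ => Uf ζ / ζ) atTop (𝓝 0) ∧ Tendsto (fun ζ => Qf ζ / ζ ^ 2) atTop (𝓝 0)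
  /-- the core at `t = 0` contains the closed backward acoustic cone of the singular point: every self-similar
  radius `ζ` at which the profile is subsonic or sonic relative to the similarity frame
  (`(ζ/r + U_f)² ≤ c² = (5/3) Q_f`, ideal monatomic sound speed) satisfies `ζ T^{1/r} < Rc` (lead's reshape 3:
  without it the reference member is self-similar on the core only kinematically, the true ideal development
  of the data is not, and nothing can track it) -/
  coneInCore : ∀ ζ, 0 ≤ ζ → (ζ / r + Uf ζ) ^ 2 ≤ 5 / 3 * Qf ζ → ζ * T ^ (1 / r) < Rc
  /-- exact self-similarity of the unsheared member on the core chart, for all `t < T` -/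
  selfSimilar : ∀ t, 0 ≤ t → t < T → ∀ y : V3, ‖y‖ < Rc →
      ρI 0 t (x₀ + Torus.proj y) = (T - t) ^ (-(3 * (1 - 1 / r))) * Pf (‖y‖ / (T - t) ^ (1 / r)) ∧
      uI 0 t (x₀ + Torus.proj y) =
        ((T - t) ^ (1 / r - 1) * Uf (‖y‖ / (T - t) ^ (1 / r)) / ‖y‖) • y ∧
      θI 0 t (x₀ + Torus.proj y) = (T - t) ^ (2 * (1 / r - 1)) * Qf (‖y‖ / (T - t) ^ (1 / r))
  /-- the Kidder relation: on the shrinking core, member `b` is the projective image of member `0`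
  (`λ = (1 - b t)⁻¹`; density weight `λ³`, velocity `λ(u - b y)`, temperature `λ²`, arguments `(λt, λy)`) -/
  kidder : ∀ b, bLo < b → ∀ t, 0 ≤ t → t < T / (1 + b * T) → ∀ y : V3, ‖y‖ < Rc * (1 - b * t) →
      ρI b t (x₀ + Torus.proj y) =
        (1 - b * t)⁻¹ ^ 3 * ρI 0 ((1 - b * t)⁻¹ * t) (x₀ + Torus.proj ((1 - b * t)⁻¹ • y)) ∧
      uI b t (x₀ + Torus.proj y) =
        (1 - b * t)⁻¹ • (uI 0 ((1 - b * t)⁻¹ * t) (x₀ + Torus.proj ((1 - b * t)⁻¹ • y)) - b • y) ∧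
      θI b t (x₀ + Torus.proj y) =
        (1 - b * t)⁻¹ ^ 2 * θI 0 ((1 - b * t)⁻¹ * t) (x₀ + Torus.proj ((1 - b * t)⁻¹ • y))

/-- Statement of `stub_kidderKnob`: given the Buckmaster–Cao-Labora–Gómez-Serrano profile theorem at
`γ = 5/3` (named fact), a knob family exists: profiles from `exists_knobProfile` (landed), `T`, `Rc`, `x₀`
chosen with `16 Rc < 1/2` so every member's core stays inside the chart, data = smooth positive cut-off
extensions of the core profiles with `∫ a₀ = 1` arranged off the core, reference fields = the self-similar
ansatz and its Kidder images (torus-chart calculus only; no hyperbolic PDE theory). -/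
def KidderKnob : Prop :=
  Literature.Analysis.FluidPDE.BuckmasterCaolaboraGomezserrano2025_thm11_monatomic → Nonempty KnobFamily

/-! ## The two-parameter thickening and the tracking predicate -/

/-- **Stable extension** of a knob family (interface; produced by `stub_knobTracking`; kinematic like
`KnobFamily`): a second, continuous parameter `β ∈ (−β₀, β₀)` moving the UNSHEARED datum inside the stable
set of the same self-similar implosion (the reference fields of each member `(0, β)` still implode, at
`Tβ β`, with the base profile as their self-similar limit up to the exact scaling/normalisation symmetries),
the knob `b` acting on every `β`-slice by the same shear with the same Kidder relation. `β = 0` is the knob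
family itself. Intended direction: the slowest stable smooth radial mode (`Λ ≈ −0.31718`) of `SS(r₂)`. -/
structure StableExtension (F : KnobFamily) where
  β₀ : ℝ
  hβ₀ : 0 < β₀
  /-- activity and temperature data of slice `β` (knob-independent), velocity datum of member `(b, β)` -/
  a : ℝ → T3 → ℝ
  θ : ℝ → T3 → ℝ
  u : ℝ → ℝ → T3 → V3
  /-- blow-up time of the unsheared member `(0, β)` -/
  Tβ : ℝ → ℝ
  /-- ideal development of member `(b, β)` -/
  ρI : ℝ → ℝ → ℝ → T3 → ℝ
  θI : ℝ → ℝ → ℝ → T3 → ℝ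
  uI : ℝ → ℝ → ℝ → T3 → V3
  base : a 0 = F.a₀ ∧ θ 0 = F.θ₀ ∧ (∀ b, u b 0 = F.u₀ b) ∧ Tβ 0 = F.T ∧
    ∀ b, ρI b 0 = F.ρI b ∧ θI b 0 = F.θI b ∧ uI b 0 = F.uI b
  cont : ∀ β, Continuous (a β) ∧ Continuous (θ β) ∧ ∀ b, Continuous (u b β)
  contβ : Continuous Tβ ∧ ∀ x, Continuous (fun β => a β x) ∧ Continuous (fun β => θ β x) ∧
    ∀ b, Continuous (fun β => u b β x)
  pos : ∀ β x, 0 < a β x ∧ 0 < θ β x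
  smoothActivity : ∀ β, Torus.IsSmooth (fun x => a β x / ∫ y, a β y)
  hT : ∀ β, |β| < β₀ → 0 < Tβ β ∧ -1 < F.bLo * Tβ β
  knobData : ∀ (b β : ℝ) (y : V3), ‖y‖ < F.Rc →
    u b β (F.x₀ + Torus.proj y) = u 0 β (F.x₀ + Torus.proj y) - b • y
  data : ∀ b β, F.bLo < b → |β| < β₀ →
    (∀ x, ρI b β 0 x = a β x / ∫ y, a β y) ∧ uI b β 0 = u b β ∧ θI b β 0 = θ β
  kidder : ∀ b β, F.bLo < b → |β| < β₀ → ∀ t, 0 ≤ t → t < Tβ β / (1 + b * Tβ β) →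
    ∀ y : V3, ‖y‖ < F.Rc * (1 - b * t) →
      ρI b β t (F.x₀ + Torus.proj y) =
        (1 - b * t)⁻¹ ^ 3 * ρI 0 β ((1 - b * t)⁻¹ * t) (F.x₀ + Torus.proj ((1 - b * t)⁻¹ • y)) ∧
      uI b β t (F.x₀ + Torus.proj y) =
        (1 - b * t)⁻¹ • (uI 0 β ((1 - b * t)⁻¹ * t) (F.x₀ + Torus.proj ((1 - b * t)⁻¹ • y)) - b • y) ∧
      θI b β t (F.x₀ + Torus.proj y) =
        (1 - b * t)⁻¹ ^ 2 * θI 0 β ((1 - b * t)⁻¹ * t) (F.x₀ + Torus.proj ((1 - b * t)⁻¹ • y))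
  /-- every unsheared member implodes self-similarly with the base profile (up to scaling `κ`, `c`) -/
  asymptotic : ∀ β, |β| < β₀ → ∃ κ c : ℝ, 0 < κ ∧ 0 < c ∧ ∀ ζ : V3,
    Tendsto (fun t => (Tβ β - t) ^ (3 * (1 - 1 / F.r)) *
        ρI 0 β t (F.x₀ + Torus.proj (((Tβ β - t) ^ (1 / F.r)) • ζ)))
      (𝓝[<] (Tβ β)) (𝓝 (c * F.Pf (‖ζ‖ / κ)))

variable {F : KnobFamily}

/-- Kidder blow-up time of member `(b, β)`: `Tβ/(1 + b Tβ)`. -/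
def StableExtension.Tp (E : StableExtension F) (b β : ℝ) : ℝ := E.Tβ β / (1 + b * E.Tβ β)

/-- **Tracking predicate** (intrinsic, PDE-level). Member `(b, β)` TRACKS TO
THRESHOLD `thr`: for all small `σ` there is an ADMISSIBLE hard-sphere-Euler solution from the member's data
which, after a blow-up-time modulation `s` with `|s| ≤ M σ³`, stays within relative density error `δ` of the
member's ideal development on the self-similarly shrinking core ball
`{x₀ + proj(Rc ((T_p − t − s)/T_p)^{1/r} ζ) : ‖ζ‖ ≤ 1}` for as long as it is followed, and whose CENTRAL
packing `ρ(t, x₀) σ³` reaches `thr σ` before it stops being followed. -/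
def TracksTo (F : KnobFamily) (E : StableExtension F) (M δ b β : ℝ) (thr : ℝ → ℝ) : Prop :=
  ∃ σ₁ : ℝ, 0 < σ₁ ∧ ∀ σ : ℝ, 0 < σ → σ < σ₁ →
    ∃ (T' s : ℝ) (ρ θ : ℝ → T3 → ℝ) (u : ℝ → T3 → V3),
      IsAdmissible σ (E.a β) (E.θ β) (E.u b β) T' ρ θ u ∧ |s| ≤ M * σ ^ 3 ∧ 0 < T' ∧
      T' + s ≤ E.Tp b β ∧
      (∀ t, 0 ≤ t → 0 ≤ t + s → t < T' → ∀ ζ : V3, ‖ζ‖ ≤ 1 →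
        |ρ t (F.x₀ + Torus.proj ((F.Rc * ((E.Tp b β - (t + s)) / E.Tp b β) ^ (1 / F.r)) • ζ)) /
            E.ρI b β (t + s)
              (F.x₀ + Torus.proj ((F.Rc * ((E.Tp b β - (t + s)) / E.Tp b β) ^ (1 / F.r)) • ζ)) - 1| ≤ δ) ∧
      ∃ t, 0 ≤ t ∧ t < T' ∧ thr σ ≤ ρ t F.x₀ * σ ^ 3

/-! ## Stub 3a — cone locality (domain of dependence) for the full athermal Euler system on `ℝ³`

Vocabulary deliberately that of `Literature/Analysis/FluidPDE/IsentropicEulerFiniteSpeedOfPropagation.lean`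
(curried fields on a slab `[0, t₁) × ℝ³`, `C¹` jointly, equations at interior times on the open backward cone
`‖x − x₀‖ + c t < R`, Mathlib `deriv` / `fderiv` / `gradient`), for the PRIMITIVE full system of a monatomic fluid
(`e = 3θ/2`) with an athermal pressure law `p = ρ θ ζ(ρ)` — the three point relations
`IsHardSphereEulerSolution.timeDeriv_density_eq / density_mul_timeDeriv_velocity_eq / timeDeriv_temperature_eq`
of `HardSphereEulerPrimitiveForm.lean` read in a chart. -/

/-- The primitive full Euler system of a monatomic fluid with athermal pressure law `p = P Θ ζ(P)`, internal
energy `3Θ/2`, at the space–time point `(t, x) ∈ ℝ × ℝ³`, for curried fields `P, Θ : ℝ → ℝ³ → ℝ`,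
`U : ℝ → ℝ³ → ℝ³`: continuity `∂ₜP + U·∇P + P div U = 0`, momentum
`P(∂ₜU + (U·∇)U) + Θ(ζ(P) + Pζ′(P))∇P + Pζ(P)∇Θ = 0`, temperature `∂ₜΘ + U·∇Θ + (2/3)Θζ(P) div U = 0`
(`div U = ∑ᵢ (∂ᵢU)ᵢ`, `(U·∇)U = DU(U)`). `ζ ≡ 1`: the monatomic ideal gas; `ζ(r) = Z(rσ³)`: hard spheres. -/
def AthermalEulerAt (ζ : ℝ → ℝ) (P Θ : ℝ → V3 → ℝ) (U : ℝ → V3 → V3) (t : ℝ) (x : V3) : Prop :=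
  deriv (fun s => P s x) t + fderiv ℝ (P t) x (U t x) +
      P t x * ∑ i, fderiv ℝ (U t) x (EuclideanSpace.single i 1) i = 0 ∧
  P t x • (deriv (fun s => U s x) t + fderiv ℝ (U t) x (U t x)) +
      (Θ t x * (ζ (P t x) + P t x * deriv ζ (P t x))) • gradient (P t) x +
      (P t x * ζ (P t x)) • gradient (Θ t) x = 0 ∧
  deriv (fun s => Θ s x) t + fderiv ℝ (Θ t) x (U t x) +
      2 / 3 * Θ t x * ζ (P t x) * ∑ i, fderiv ℝ (U t) x (EuclideanSpace.single i 1) i = 0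

/-- **Cone locality** (finite speed of propagation / local uniqueness in acoustic cones) for classical solutions of
the full Euler system of a monatomic fluid with one smooth athermal pressure law `p = ρθζ(ρ)` (Dafermos 2005,
Thm 5.2.1, classical-vs-classical case; the `5 × 5` analogue of the tree's `IsentropicEuler.eqOn_cone_of_eqOn_ball`).
Data: `ζ` smooth on an open `J ⊇ [a, b]`, `a > 0`, hyperbolic there (`ζ + rζ′ > 0`); two triples `(Pₖ, Uₖ, Θₖ)`
jointly `C¹` on the slab `[0, t₁) × ℝ³`, solving the system at interior times on the open cone
`‖x − x₀‖ + c t < R`, with densities in `[a, b]` and positive temperatures on that cone; `c ≥ 0` dominating the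
characteristic speed `‖U₁‖ + c_s(P₁, Θ₁)`, `c_s² = Θ(ζ + Pζ′) + (2/3)Θζ²` (adiabatic sound speed of the athermal
law), of the FIRST solution on the cone; equal data on the ball `‖x − x₀‖ < R`. Conclusion: the two triples agree on
the whole cone `‖x − x₀‖ + c t < R`, `0 ≤ t < t₁`. (Proof plan: weighted symmetrised relative energy
`½(Aα² + P|w|² + Bβ²)`, `A = Θ(ζ + Pζ′)/P`, `B = 3P/(2Θ)`, flux `(U·n)e + (Θγα + Pζβ)(w·n) ≤ (‖U‖ + c_s)e`,
smooth cone weight `χ(R − ct − (ε² + ‖x − x₀‖²)^{1/2})`, Grönwall — verbatim the isentropic file's route.) -/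
def HsEulerConeLocality : Prop :=
  ∀ (ζ : ℝ → ℝ) (J : Set ℝ) (a b : ℝ), IsOpen J → ContDiffOn ℝ ∞ ζ J → Set.Icc a b ⊆ J → 0 < a →
    (∀ r ∈ Set.Icc a b, 0 < ζ r + r * deriv ζ r) →
  ∀ (P₁ Θ₁ P₂ Θ₂ : ℝ → V3 → ℝ) (U₁ U₂ : ℝ → V3 → V3) (x₀ : V3) (R c t₁ : ℝ),
    ContDiffOn ℝ 1 (fun p : ℝ × V3 => P₁ p.1 p.2) (Set.Ico 0 t₁ ×ˢ Set.univ) →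
    ContDiffOn ℝ 1 (fun p : ℝ × V3 => Θ₁ p.1 p.2) (Set.Ico 0 t₁ ×ˢ Set.univ) →
    ContDiffOn ℝ 1 (fun p : ℝ × V3 => U₁ p.1 p.2) (Set.Ico 0 t₁ ×ˢ Set.univ) →
    ContDiffOn ℝ 1 (fun p : ℝ × V3 => P₂ p.1 p.2) (Set.Ico 0 t₁ ×ˢ Set.univ) →
    ContDiffOn ℝ 1 (fun p : ℝ × V3 => Θ₂ p.1 p.2) (Set.Ico 0 t₁ ×ˢ Set.univ) →
    ContDiffOn ℝ 1 (fun p : ℝ × V3 => U₂ p.1 p.2) (Set.Ico 0 t₁ ×ˢ Set.univ) →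
    (∀ t ∈ Set.Ico 0 t₁, ∀ x, ‖x - x₀‖ + c * t < R →
      P₁ t x ∈ Set.Icc a b ∧ P₂ t x ∈ Set.Icc a b ∧ 0 < Θ₁ t x ∧ 0 < Θ₂ t x) →
    (∀ t ∈ Set.Ioo 0 t₁, ∀ x, ‖x - x₀‖ + c * t < R →
      AthermalEulerAt ζ P₁ Θ₁ U₁ t x ∧ AthermalEulerAt ζ P₂ Θ₂ U₂ t x) →
    0 ≤ c →
    (∀ t ∈ Set.Ioo 0 t₁, ∀ x, ‖x - x₀‖ + c * t < R →
      ‖U₁ t x‖ + Real.sqrt (Θ₁ t x * (ζ (P₁ t x) + P₁ t x * deriv ζ (P₁ t x)) +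
        2 / 3 * Θ₁ t x * ζ (P₁ t x) ^ 2) ≤ c) →
    (∀ x, ‖x - x₀‖ < R → P₁ 0 x = P₂ 0 x ∧ U₁ 0 x = U₂ 0 x ∧ Θ₁ 0 x = Θ₂ 0 x) →
    ∀ t ∈ Set.Ico 0 t₁, ∀ x, ‖x - x₀‖ + c * t < R → P₁ t x = P₂ t x ∧ U₁ t x = U₂ t x ∧ Θ₁ t x = Θ₂ t x

/-! ## Stub 3b — the ideal development of a knob member on the core cone -/

/-- **Member-core identification.** For every knob family `F`, every member `b > bLo` and every time
`t₁` before its Kidder time `T/(1 + bT)` there is a speed `c ≥ 0` (bounding the characteristic speed of the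
reference on the core up to `t₁`, and `≥ Rc·b` so that the straight cone stays in the shrinking core) such that
EVERY classical ideal (`σ = 0`) development on `𝕋³` of the member's data `(a₀/∫a₀, u₀ b, θ₀)`, on any horizon
`T'`, coincides with the member's reference fields `(ρI b, uI b, θI b)` on the straight acoustic cone
`‖y‖ + c t < Rc`, `0 ≤ t < min t₁ T'`, of the core chart. (On that region the reference IS the Kidder image of the
exact self-similar core by `selfSimilar` + `kidder`, hence a classical ideal solution by `profileODE` +
`ProjectiveCovariance`; the torus solution read in the chart is another; both have the member's data on the ball;
`HsEulerConeLocality` at `ζ ≡ 1` concludes.) This is what makes the kinematic reference fields of `KnobFamily` the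
true `σ = 0` developments that `TracksTo` shadows. -/
def MemberCore : Prop :=
  ∀ (F : KnobFamily) (b t₁ : ℝ), F.bLo < b → 0 < t₁ → t₁ < F.T / (1 + b * F.T) →
    ∃ c : ℝ, 0 ≤ c ∧ ∀ (T' : ℝ) (ρ θ : ℝ → T3 → ℝ) (u : ℝ → T3 → V3),
      IsHardSphereEulerSolution 0 T' ρ u θ → (∀ x, ρ 0 x = F.a₀ x / ∫ y, F.a₀ y) → u 0 = F.u₀ b →
      θ 0 = F.θ₀ → ∀ t ∈ Set.Ico 0 (min t₁ T'), ∀ y : V3, ‖y‖ + c * t < F.Rc →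
        ρ t (F.x₀ + Torus.proj y) = F.ρI b t (F.x₀ + Torus.proj y) ∧
        u t (F.x₀ + Torus.proj y) = F.uI b t (F.x₀ + Torus.proj y) ∧
        θ t (F.x₀ + Torus.proj y) = F.θI b t (F.x₀ + Torus.proj y)

/-! ## Stub 3 — tuned tracking on the thickened knob (the merged Melnikov reduction + transfer) -/

/-- Statement of `stub_knobTracking` (the HARDEST stub; it REPLACES the planner's pair
`stub_melnikovReduction` + `stub_knobTransfer`, see the module docstring §Reshape): given the projective
covariance (the cubic structure of the first tuning function along the knob) and the tied statics (the data
defect `σ³ h₁ + σ⁶ h₂ + O(σ⁹)` and the admissibility of the tracked solutions), EVERY knob family admits a stable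
extension (direction and range chosen by the prover — intended: the slowest stable smooth radial mode
`Λ ≈ −0.31718` of `SS(r₂)`) containing a member `(b, β)` that TRACKS TO A FIXED PACKING `η > 0`: for all small
`σ` an admissible hard-sphere-Euler solution from the member's data shadows the member's ideal development,
after a blow-up-time modulation `|s| ≤ M σ³`, within relative density error `δ ≤ 1/2` on the self-similarly
shrinking core, until its central packing reaches `η`. Content (unchanged from the planner's two stubs, now in
one statement): classical well-posedness of the hard-sphere system at small packing (`Z` analytic near `0`:
route support `HsEosLowDensity`, stmt-0768, taken BY NAME as a hypothesis), forced modulation stability in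
self-similar variables around `SS(r₂)` with forcing `O(packing)`, the amplitude law
`a(τ) = e^{Λ₁τ}(σ³ K₁(b,β) + σ⁶ K₂(b,β)) + O(packing) + O(packing³)` with `2μ < Λ₁ < 3μ` (orders `σ^{3k}`,
`k ≥ 3`, slaved), `b ↦ K₁(b,β)` a cubic (Kidder pull-back to ONE orbit), and a COMMON ZERO of `(K₁, K₂)` on
the two-parameter family (the bet of the line; cheapest falsifier: the three adjoint pairings
`(k_H, φ_p, φ_h)` at `SS(r₂)`, TRIAGE-r1-1 §kidder sharpen, then `K₂` along `{K₁ = 0}`). -/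
def KnobTracking : Prop :=
  ∀ F : KnobFamily, ∃ (E : StableExtension F) (b β M δ η : ℝ),
    F.bLo < b ∧ |β| < E.β₀ ∧ 0 < η ∧ 0 < δ ∧ δ ≤ 1 / 2 ∧ TracksTo F E M δ b β (fun _ => η)


/-! ## Registered stubs -/

/-- STUB 0 (size M; shared verbatim with `PolynomialCompression/Lines/conformal-clock.lean`, stub 3 there):
projective covariance of the monatomic full Euler system with a general equation of state — chain rule;
Serre 1997 Prop. 2.1 / Kidder 1974 at `Z ≡ 1`. Leans on: Mathlib `fderiv` calculus only. -/
theorem stub_projectiveCovariance : ProjectiveCovariance := by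
  -- LANDED (wave 1, p72839): the Theorems copy of the Stub-0 block is byte-identical, hence defeq.
  exact Theorems.KidderKnobMelnikov.stub_projectiveCovariance

/-- STUB 1 (size M–L): tied smooth low-density statics to second order in `σ³` with the explicit first-order
defect `defect₁`. Leans on: `localGibbs_lln_holds` / `localGibbs_densityLLN_holds`,
`isProbabilityMeasure_localGibbsLaw`, `rhoLim`/cluster-coefficient API of the tree (as used by the sibling
`SmoothStatics`), Disproof §5b (`admissible_initialDensity_sub_le`) as the `m = 0`, first-order sanity check;
Ruelle1969 §3.4–4, LebowitzPenrose1964. -/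
theorem stub_tiedStatics : TiedStatics := by
  -- LANDED (wave 1, p73015 + helper p72666): byte-identical `defect₁`/`TiedStatics`, hence defeq.
  exact Theorems.KidderKnobMelnikov.stub_tiedStatics

/-- STUB 2 (size M–L after reshape 2): the knob family exists, from the named fact
`Literature.Analysis.FluidPDE.BuckmasterCaolaboraGomezserrano2025_thm11_monatomic` (BCG 2025 Thm 1.1 at
`γ = 5/3`, vendored p72836). Leans on: the landed `Theorems.KidderKnobMelnikov.exists_knobProfile`
(profiles `Pf = (S/3r)³, Uf = U/r, Qf = S²/(15r²)` with `hr`, `smoothProfile`, `profilePos`, `isentropic`,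
`profileODE`, `farField`), `contDiffOn_selfSimilarField`, torus chart calculus (`Torus.proj`, `Torus.lift`,
`Torus.IsSmooth`; smooth cut-offs); no PDE theory (the planner's global ideal developments `sol` were dropped:
they need the unvendored classical Cauchy theory on `𝕋³` and are read by nothing downstream). -/
theorem stub_kidderKnob : KidderKnob := by
  -- LANDED (wave 2, p75242) as `Theorems.KidderKnobMelnikov.stub_kidderKnob` over a verbatim copy of `KnobFamily`
  -- (a distinct structure type): field-by-field transport.
  intro h
  obtain ⟨F⟩ := Theorems.KidderKnobMelnikov.stub_kidderKnob h
  exact ⟨{ x₀ := F.x₀, Rc := F.Rc, T := F.T, r := F.r, bLo := F.bLo, a₀ := F.a₀, θ₀ := F.θ₀, u₀ := F.u₀,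
           Pf := F.Pf, Uf := F.Uf, Qf := F.Qf, ρI := F.ρI, θI := F.θI, uI := F.uI, hRc := F.hRc, hT := F.hT,
           hr := F.hr, hbLo := F.hbLo, cont := F.cont, pos := F.pos, smoothActivity := F.smoothActivity,
           knobData := F.knobData, data := F.data, smoothProfile := F.smoothProfile, profilePos := F.profilePos,
           isentropic := F.isentropic, profileODE := F.profileODE, farField := F.farField,
           coneInCore := F.coneInCore, selfSimilar := F.selfSimilar, kidder := F.kidder }⟩

/-- STUB 3 (size XL — the HARDEST; the crux's "forced finite-codimension stability with the count
`(m, J) = (1, 2)` AND the two tuning conditions met" on the thickened Kidder knob): `KnobTracking` from the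
projective covariance, the tied statics and the route support `HsEosLowDensity` (stmt-0768, hypothesis; the
classical Cauchy theory at `σ > 0` — Kato1975/Majda1984 — is used inside; since reshape 3 also the cone locality of the
real-gas system and the member-core identification, stubs 3a–3b, by name). Leans on: route supports
`EosContinuity` (stmt-12589); CGSS-type self-similar energy estimates (arXiv:2310.05325 §2–3) for the forced
problem; the spectral input `m = 1`, `2μ < Λ₁ < 3μ` at `SS(r₂)` (RaceResults.md; to be certified by interval
arithmetic, BCG-style); the `σ = 0` stable set of `SS(r₂)` for the extension; certified quadratures for the
cubic `K₁(·,β)` and for `K₂` (kit). Kill criterion of the line: the cubic `k_H + φ_p P(λ*) + φ_h Q(λ*)` has no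
root in `λ* = 1 + bT ∈ (1/16, ∞)` for `|β| < β₀`, or `K₂` keeps one sign along `{K₁ = 0}`. -/
theorem stub_knobTracking : ProjectiveCovariance → TiedStatics → HsEosLowDensity → HsEulerConeLocality →
    MemberCore → KnobTracking := by
  sorry


/-- STUB 3a (size L; NEW in reshape 3): cone locality for the full athermal Euler system on `ℝ³` — the `5 × 5`
analogue of the landed `IsentropicEuler.eqOn_cone_of_eqOn_ball` (Dafermos 2005 Thm 5.2.1, classical case). Leans on:
that file's weight / integration-by-parts / Grönwall machinery (`contDiff_coneWeight`, `coneWeight_flux_le`,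
`integral_mul_fderiv_eq_neg`, `eqOn_of_weight` as the model), the symmetriser algebra of
`IsHardSphereEulerSolution.relativeEnergy_balance` / `HsEulerCalc.remainder_alg_le` / `energy_alg_ge`
(`HardSphereEulerPrimitiveForm.lean`, `HardSphereEulerClassicalUniqueness.lean`) redone pointwise in `fderiv` form, and the
flux bound `|(Θγα + Pζβ)(w·n)| ≤ c_s e`, `c_s² = Θγ + (2/3)Θζ²` (Cauchy–Schwarz with the weights `A = Θγ/P`, `B = 3P/(2Θ)`). -/
theorem stub_coneLocality : HsEulerConeLocality :=
  -- LANDED (seat -2, wave 1, p106649 `Theorems.KidderKnobMelnikov.stub_coneLocality`): the Theorems copy of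
  -- `AthermalEulerAt` / `HsEulerConeLocality` (`…ConeDefs.lean`) is byte-identical, hence defeq.
  Theorems.KidderKnobMelnikov.stub_coneLocality

/-- STUB 3b (size M–L; NEW in reshape 3): the member-core identification from cone locality at `ζ ≡ 1` and the projective
covariance. Leans on: `KnobFamily.selfSimilar/kidder/data/profileODE/smoothProfile/coneInCore`, the landed
`Theorems.KidderKnobMelnikov.stub_projectiveCovariance` (`EulerZAt` with `Z ≡ 1`, `h`-term vanishing), the chart calculus
`Torus.stLift` / `Torus.liftAt` / `Torus.fderiv_lift` / `Torus.lift_lineDeriv` (torus solution read in the chart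
`y ↦ x₀ + proj y` is a `C^∞` solution of `AthermalEulerAt 1` on `[0, T') × ℝ³`: `hsPressure 0 ρ θ = ρθ` by
`hsCompressibility_zero`, primitive form by `IsHardSphereEulerSolution.timeDeriv_density_eq` & co.), the self-similar ansatz
solving the ideal system (`contDiffOn_selfSimilarField`, cf. `Literature.Analysis.FluidPDE.uσ_system_of_ansatz`), a bump
extension of the reference off a slightly smaller cone, and continuity bounds for the speed on the compact cone. -/
theorem stub_memberCore : HsEulerConeLocality → ProjectiveCovariance → MemberCore := by
  -- LANDED (seat -2, wave 1, p105582 `Theorems.KidderKnobMelnikov.stub_memberCore` /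
  -- `memberCore_of_coneLocality`) over the Theorems copy of `KnobFamily` (a distinct structure type with the
  -- same 31 fields): field-by-field transport, as for `stub_kidderKnob`.
  intro hcone _ F b t₁ hb ht₁ ht
  exact Theorems.KidderKnobMelnikov.memberCore_of_coneLocality hcone
    { x₀ := F.x₀, Rc := F.Rc, T := F.T, r := F.r, bLo := F.bLo, a₀ := F.a₀, θ₀ := F.θ₀, u₀ := F.u₀,
      Pf := F.Pf, Uf := F.Uf, Qf := F.Qf, ρI := F.ρI, θI := F.θI, uI := F.uI, hRc := F.hRc, hT := F.hT,
      hr := F.hr, hbLo := F.hbLo, cont := F.cont, pos := F.pos, smoothActivity := F.smoothActivity,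
      knobData := F.knobData, data := F.data, smoothProfile := F.smoothProfile, profilePos := F.profilePos,
      isentropic := F.isentropic, profileODE := F.profileODE, farField := F.farField,
      coneInCore := F.coneInCore, selfSimilar := F.selfSimilar, kidder := F.kidder } b t₁ hb ht₁ ht

/-- STUB 4 (INPUT, vendoring-scale): the Buckmaster–Cao-Labora–Gómez-Serrano profile theorem at `γ = 5/3`
(Forum Math. Pi 13 (2025), Thm 1.1; computer-assisted in print), i.e. a Lean PROOF of the named Literature fact
`Literature.Analysis.FluidPDE.BuckmasterCaolaboraGomezserrano2025_thm11_monatomic` (vendored p72836 as a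
`def … : Prop`). Declared as a stub because the skeleton checker admits only registered obligations as hypotheses of
the composition; the honest long-term shape is a route support item `(h : BCG…) →` (planner: route edit), exactly as
`IdealGasImplosion` is meant to be re-filed over `CaolaboraEtAl2025_thm12_euler`. Nobody is expected to land this
inside the line. -/
theorem stub_bcgProfile : Literature.Analysis.FluidPDE.BuckmasterCaolaboraGomezserrano2025_thm11_monatomic :=
  -- DISCHARGED BY THE TREE (2026-08-16T18:43Z, `Literature/Analysis/FluidPDE/CompressibleEulerImplosionMonatomicHolds.lean`: the
  -- shooting argument fed with Prop. 3.1 on the whole window from the 32 kernel-certified Taylor-model windows `…LeftTMW0..31`);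
  -- wired by the r2 lead c3-0 as a courtesy to the fallback line (no kidder stub signature changed; not re-registered).
  Literature.Analysis.FluidPDE.BuckmasterCaolaboraGomezserrano2025_thm11_monatomic_holds

/-! ## Composition (sorry-free) -/

/-- **Composition of the line**: knob family (stub 2, fed by the BCG fact) → a tracking member of a stable
extension (stub 3, fed by stubs 0 and 1 and `HsEosLowDensity`) → tracking to packing `η` by ADMISSIBLE
solutions of a FIXED continuous positive profile along all small `σ` → the crux, unfolded. -/
theorem denseExcursion_of_parts (hF : Nonempty KnobFamily) (h₃ : KnobTracking) :
    ∃ η : ℝ, 0 < η ∧ ∃ (a₀ θ₀ : T3 → ℝ) (u₀ : T3 → V3), Continuous a₀ ∧ Continuous θ₀ ∧ Continuous u₀ ∧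
      (∀ x, 0 < a₀ x) ∧ (∀ x, 0 < θ₀ x) ∧ ∀ σ₀ : ℝ, 0 < σ₀ → ∃ σ : ℝ, 0 < σ ∧ σ < σ₀ ∧
        ∃ (T : ℝ) (ρ θ : ℝ → T3 → ℝ) (u : ℝ → T3 → V3), IsHardSphereEulerSolution σ T ρ u θ ∧
          (∀ Φ : (N : ℕ) → Literature.Analysis.FluidPDE.HardSphereFlow
              (Literature.Analysis.FluidPDE.Torus.geometry (Fin 3)) (hsDiameter σ N) (N + 1),
            TendstoHydroFieldsAt (fun N => localGibbsLaw σ a₀ u₀ θ₀ N (Φ N)) Φ ρ u θ 0) ∧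
          ∃ t ∈ Set.Ico 0 T, ∃ x, η ≤ ρ t x * σ ^ 3 := by
  obtain ⟨F⟩ := hF
  obtain ⟨E, b, β, M, δ, η, -, -, hη, -, -, htr⟩ := h₃ F
  obtain ⟨σ₁, hσ₁, H⟩ := htr
  obtain ⟨hca, hcθ, hcu⟩ := E.cont β
  refine ⟨η, hη, E.a β, E.θ β, E.u b β, hca, hcθ, hcu b, fun x => (E.pos β x).1,
    fun x => (E.pos β x).2, fun σ₀ hσ₀ => ?_⟩
  have hσ : 0 < min σ₀ σ₁ / 2 := by positivity
  have hσσ₀ : min σ₀ σ₁ / 2 < σ₀ := by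
    have := min_le_left σ₀ σ₁
    linarith
  have hσσ₁ : min σ₀ σ₁ / 2 < σ₁ := by
    have := min_le_right σ₀ σ₁
    linarith
  obtain ⟨T', s, ρ, θ, u, ⟨hE, hΦ⟩, -, -, -, -, t, ht0, htT, hthr⟩ := H (min σ₀ σ₁ / 2) hσ hσσ₁
  exact ⟨min σ₀ σ₁ / 2, hσ, hσσ₀, T', ρ, θ, u, hE, hΦ, t, ⟨ht0, htT⟩, F.x₀, hthr⟩

/-- **The skeleton concludes the crux BY NAME.** `DenseExcursion` (route `ImplosionDichotomy`,
stmt-AtomisticToContinuum-12586) from the registered stubs (incl. the input stub `stub_bcgProfile` = BCG 2025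
Thm 1.1 at `γ = 5/3`); the route support `HsEosLowDensity` (stmt-0768) is discharged by `Theorems.hsEosLowDensity_proof`
(reshape 3), cone locality and the member-core identification are stubs 3a–3b. -/
theorem DenseExcursion_of : DenseExcursion :=
  denseExcursion_of_parts (stub_kidderKnob stub_bcgProfile)
    (stub_knobTracking stub_projectiveCovariance stub_tiedStatics Theorems.hsEosLowDensity_proof stub_coneLocality
      (stub_memberCore stub_coneLocality stub_projectiveCovariance))

end Summit.AtomisticToContinuum.HydrodynamicLimit.Cruxes.DenseExcursion.KidderKnobMelnikov

end
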